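import Summits.KontsevichZagierPeriods.KontsevichZagierPeriods.Theorems.UnfoldedStokesStokesGenerationFibrewiseRungAngSwap
import Summits.KontsevichZagierPeriods.KontsevichZagierPeriods.Theorems.UnfoldedStokesStokesGenerationStubSaPartition
import Summits.KontsevichZagierPeriods.KontsevichZagierPeriods.Theorems.UnfoldedStokesStokesGenerationFibrewiseRungAngularSectorAux
import Summits.KontsevichZagierPeriods.KontsevichZagierPeriods.Theorems.UnfoldedStokesStokesGenerationFibrewiseRungSaDlogSwap
import Summits.KontsevichZagierPeriods.KontsevichZagierPeriods.Theorems.UnfoldedStokesStokesGenerationFibrewiseRungSeparated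
import Summits.KontsevichZagierPeriods.KontsevichZagierPeriods.Theorems.UnfoldedStokesStokesGenerationStubSaMixedValue
import Summits.KontsevichZagierPeriods.KontsevichZagierPeriods.Theorems.UnfoldedStokesStokesGenerationStubKinkedAngTransport
import Summits.KontsevichZagierPeriods.KontsevichZagierPeriods.Theorems.UnfoldedStokesStokesGenerationStubClampedLoopPiece
import Summits.KontsevichZagierPeriods.KontsevichZagierPeriods.Theorems.UnfoldedStokesStokesGenerationFibrewiseRungSaMixed

/-!
# `StokesGeneration` (stmt-KontsevichZagierPeriods-3586), line `fibrewise_stokes` — rung 10e: the angular transposition for semialgebraic loops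

Crux `Summit.KontsevichZagierPeriods.KontsevichZagierPeriods.Theses.UnfoldedStokes.StokesGeneration`; residual stub S2
`stub_fibrewiseStokesGeneration` (fibrewise Stokes generation on closed unit cubes). This file banks, unconditionally and inside S2's
strict economy (`FibStokesDecomposable`), the ANGULAR SELF-TRANSPOSITION for semialgebraic C¹ loops: for `γ` algebraic and
`A, B, A', B'` ℚ-semialgebraic, continuous on `[0,1]`, `A' = dA/du`, `B' = dB/du` on `(0,1)` and `A² + B² ≠ 0` on `[0,1]`, the
two-variable integrand `γ · (ω(z 0) − ω(z 1))`, `ω = (A B' − A' B)/(A² + B²)`, is fibrewise-Stokes decomposable on `[0,1]²`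
(`fibStokesDecomposable_saAngSwap`). Unlike the polynomial case (rung 9, `fibStokesDecomposable_angSwap`, p132692) the loop
`(A, B)` need not avoid the negative real axis, so the half-angle transport of rung 9 is applied piecewise: the semialgebraic partition
of `[0,1]` (`stub_saPartition`) splits the loop into finitely many clamped pieces `(A ∘ clampₖ, B ∘ clampₖ)` each staying in an open
half-plane after a rotation (`stub_clampedLoopPiece`, p133518), the clamped pieces are only piecewise C¹ — whence the KINKED transport
package `stub_kinkedAngTransport` (p134042: elements with finite kink sets, bounded but discontinuous derivative data) — and
`ω = Σₖ ω_{pieceₖ}` on `[0,1]` reassembles the pieces (`fibStokesDecomposable_of_elementsK`, the kinked analogue of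
`fibStokesDecomposable_of_elements`).

References: M. Kontsevich, D. Zagier, *Periods* (2001), §1.2; the line card `Lines/fibrewise_stokes.md` (rungs 9–10).
-/

noncomputable section

set_option linter.dupNamespace false

namespace Summit.KontsevichZagierPeriods.KontsevichZagierPeriods.Cruxes.StokesGeneration.FibrewiseStokes

open MeasureTheory Set
open Literature.NumberTheory.Transcendental
open Literature.NumberTheory.Transcendental.KZ
open Literature.ModelTheory.ExponentialFields (IsSemialgebraic)

/-! ## A family of elements with kink sets -/

/-- **A finite family of fibrewise Stokes elements (with kink sets) on one cube has a decomposable sum.** [folklore] -/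
theorem fibStokesDecomposable_of_elementsK {M J : ℕ} (dir : Fin J → Fin M) (G D : Fin J → (Fin M → ℝ) → ℝ)
    (K : Fin J → Set (Fin M → ℝ)) (r : Fin J → IntegralRep M)
    (hpack : ∀ j, IsSemialgebraicFunOn ℚ (Set.pi Set.univ (fun _ : Fin M => Set.Icc (0:ℝ) 1)) (G j) ∧
      IsSemialgebraicFunOn ℚ (Set.pi Set.univ (fun _ : Fin M => Set.Icc (0:ℝ) 1)) (D j) ∧
      IsSemialgebraic ℚ (K j) ∧
      (∃ Bd : ℝ, ∀ x ∈ Set.pi Set.univ (fun _ : Fin M => Set.Icc (0:ℝ) 1), |(G j) x| ≤ Bd) ∧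
      (∀ x ∈ Set.pi Set.univ (fun _ : Fin M => Set.Icc (0:ℝ) 1), Set.Finite {s : ℝ | Function.update x (dir j) s ∈ (K j)}) ∧
      (∀ x ∈ Set.pi Set.univ (fun _ : Fin M => Set.Icc (0:ℝ) 1),
        ContinuousOn (fun s : ℝ => (G j) (Function.update x (dir j) s)) (Set.Icc (0:ℝ) 1)) ∧
      (∀ x ∈ Set.pi Set.univ (fun _ : Fin M => Set.Icc (0:ℝ) 1), x ∉ (K j) → x (dir j) ∈ Set.Ioo (0:ℝ) 1 →
        HasDerivAt (fun s : ℝ => (G j) (Function.update x (dir j) s)) ((D j) x) (x (dir j))))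
    (hr : ∀ j, (r j).domain = Set.pi Set.univ (fun _ : Fin M => Set.Icc (0:ℝ) 1) ∧
      ∀ x ∈ Set.pi Set.univ (fun _ : Fin M => Set.Icc (0:ℝ) 1), (r j).integrand x =
        D j x - (G j (Function.update x (dir j) 1) - G j (Function.update x (dir j) 0))) :
    FibStokesDecomposable M (fun x => ∑ j, (r j).integrand x) :=
  ⟨M, le_rfl, J, dir, G, D, K, r, ∅, hpack, hr, Literature.ModelTheory.ExponentialFields.isSemialgebraic_empty, measure_empty,
    fun _ _ _ => rfl⟩

/-! ## Rung 10e: the angular self-transposition for semialgebraic loops -/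

/-- **S2 absorbs the coordinate transposition of the angular atom of every SEMIALGEBRAIC loop (rung 10e; lead c5).** For a zero-free
loop `P = A + iB` on `[0,1]` with `A, B, A′, B′` `ℚ`-semialgebraic and continuous, `A, B` differentiable on `(0,1)`, and `γ` algebraic,
`γ(ω_P(x₀) − ω_P(x₁))` is fibrewise-Stokes decomposable on the square: partition `[0,1]` rationally so that each piece stays in the
half-plane `Re(· conj P(zₖ)) > 0` (`stub_saPartition`), clamp and rotate the loop to each piece (`stub_clampedLoopPiece`: continuous,
kinked at the two grid points, `Re > 0`), transpose each piece by the kinked transport (`stub_kinkedAngTransport`) and four half-angle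
certificates whose faces telescope (rung 9a's algebra), and sum over the pieces — `ω_P = Σₖ ω_{Pₖ}` off the grid. Baker-free.
[cite: KontsevichZagier2001, §1.2 rule (2)] -/
theorem fibStokesDecomposable_saAngSwap (γ : ℝ) (A B A' B' : ℝ → ℝ) (hγ : IsAlgebraic ℚ γ)
    (hA : IsSemialgebraicFunOn ℚ (Set.pi Set.univ (fun _ : Fin 1 => Set.Icc (0:ℝ) 1)) (fun z => A (z 0))) (hB : IsSemialgebraicFunOn ℚ (Set.pi Set.univ (fun _ : Fin 1 => Set.Icc (0:ℝ) 1)) (fun z => B (z 0)))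
    (hA' : IsSemialgebraicFunOn ℚ (Set.pi Set.univ (fun _ : Fin 1 => Set.Icc (0:ℝ) 1)) (fun z => A' (z 0))) (hB' : IsSemialgebraicFunOn ℚ (Set.pi Set.univ (fun _ : Fin 1 => Set.Icc (0:ℝ) 1)) (fun z => B' (z 0)))
    (hAc : ContinuousOn A (Set.Icc (0:ℝ) 1)) (hBc : ContinuousOn B (Set.Icc (0:ℝ) 1))
    (hA'c : ContinuousOn A' (Set.Icc (0:ℝ) 1)) (hB'c : ContinuousOn B' (Set.Icc (0:ℝ) 1))
    (hAd : ∀ u ∈ Set.Ioo (0:ℝ) 1, HasDerivAt A (A' u) u) (hBd : ∀ u ∈ Set.Ioo (0:ℝ) 1, HasDerivAt B (B' u) u)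
    (hAB : ∀ u ∈ Set.Icc (0:ℝ) 1, A u ^ 2 + B u ^ 2 ≠ 0) :
    FibStokesDecomposable 2 (fun z => γ * ((A (z 0) * B' (z 0) - A' (z 0) * B (z 0)) / (A (z 0) ^ 2 + B (z 0) ^ 2) -
      (A (z 1) * B' (z 1) - A' (z 1) * B (z 1)) / (A (z 1) ^ 2 + B (z 1) ^ 2))) := by
  classical
  have hS1 := isSemialgebraic_cubePi_one
  have h0 : (0:ℝ) ∈ Set.Icc (0:ℝ) 1 := ⟨le_rfl, zero_le_one⟩
  have h1 : (1:ℝ) ∈ Set.Icc (0:ℝ) 1 := ⟨zero_le_one, le_rfl⟩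
  set ω : ℝ → ℝ := fun u => (A u * B' u - A' u * B u) / (A u ^ 2 + B u ^ 2) with hω
  -- Step 1: the partition
  obtain ⟨N, hN1, hpos, -, -⟩ := stub_saPartition A B 0 hAc hBc hAB le_rfl
  have hNpos : (0:ℝ) < N := by exact_mod_cast hN1
  have hNne : (N:ℝ) ≠ 0 := hNpos.ne'
  set z : ℕ → ℝ := fun k => (k : ℝ) / N with hz
  have hz_succ : ∀ k : ℕ, z (k + 1) = ((k : ℝ) + 1) / N := fun k => by simp [hz]
  have hz_lt : ∀ k : ℕ, z k < z (k + 1) := fun k => by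
    rw [hz_succ]; exact div_lt_div_of_pos_right (by linarith) hNpos
  have hz_nonneg : ∀ k : ℕ, 0 ≤ z k := fun k => by positivity
  have hz_le_one : ∀ k : ℕ, k ≤ N → z k ≤ 1 := fun k hk => by
    rw [div_le_one hNpos]; exact_mod_cast hk
  have hz_mem : ∀ k : ℕ, k ≤ N → z k ∈ Set.Icc (0:ℝ) 1 := fun k hk => ⟨hz_nonneg k, hz_le_one k hk⟩
  have hz_alg : ∀ k : ℕ, IsAlgebraic ℚ (z k) := fun k => isAlgebraic_natCast_div k N
  -- Step 2: the clamped rotated pieces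
  have hpiece : ∀ k : Fin N, ∃ (U W U' W' : ℝ → ℝ),
      IsSemialgebraicFunOn ℚ (Set.pi Set.univ (fun _ : Fin 1 => Set.Icc (0:ℝ) 1)) (fun w => U (w 0)) ∧ IsSemialgebraicFunOn ℚ (Set.pi Set.univ (fun _ : Fin 1 => Set.Icc (0:ℝ) 1)) (fun w => W (w 0)) ∧
      IsSemialgebraicFunOn ℚ (Set.pi Set.univ (fun _ : Fin 1 => Set.Icc (0:ℝ) 1)) (fun w => U' (w 0)) ∧ IsSemialgebraicFunOn ℚ (Set.pi Set.univ (fun _ : Fin 1 => Set.Icc (0:ℝ) 1)) (fun w => W' (w 0)) ∧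
      ContinuousOn U (Set.Icc (0:ℝ) 1) ∧ ContinuousOn W (Set.Icc (0:ℝ) 1) ∧
      (∀ u ∈ Set.Icc (0:ℝ) 1, 0 < U u) ∧
      (∃ Bd : ℝ, ∀ u ∈ Set.Icc (0:ℝ) 1, |U' u| ≤ Bd ∧ |W' u| ≤ Bd) ∧
      (∀ u ∈ Set.Ioo (0:ℝ) 1, u ≠ z k → u ≠ z (k + 1) → HasDerivAt U (U' u) u ∧ HasDerivAt W (W' u) u) ∧
      (∀ u ∈ Set.Icc (0:ℝ) 1, U u = A (max (z k) (min u (z (k + 1)))) * A (z k) + B (max (z k) (min u (z (k + 1)))) * B (z k)) ∧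
      (∀ u ∈ Set.Icc (0:ℝ) 1, W u = B (max (z k) (min u (z (k + 1)))) * A (z k) - A (max (z k) (min u (z (k + 1)))) * B (z k)) ∧
      ∀ u ∈ Set.Icc (0:ℝ) 1, u ≠ z k → u ≠ z (k + 1) →
        (U u * W' u - U' u * W u) / (U u ^ 2 + W u ^ 2) = if z k < u ∧ u < z (k + 1) then ω u else 0 := fun k =>
    stub_clampedLoopPiece A B A' B' (z k) (z (k + 1)) hA hB hA' hB' hAc hBc hA'c hB'c hAd hBd hAB (hz_alg k) (hz_alg (k + 1))
      (hz_nonneg k) (hz_lt k) (hz_le_one (k + 1) k.2) (fun u hu => by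
        have hu' : u ∈ Set.Icc ((k:ℝ) / N) (((k:ℝ) + 1) / N) := by rwa [← hz_succ]
        exact hpos k k.2 u hu')
  choose U W U' W' hUsa hWsa hU'sa hW'sa hUc hWc hUpos hbd hder hUeq hWeq hωk using hpiece
  -- Step 3: one transposition per piece (kinked transport + four half-angle certificates)
  have h20 : (2 : Fin 4) ≠ 0 := by decide
  have h30 : (3 : Fin 4) ≠ 0 := by decide
  have h21 : (1 : Fin 4) ≠ 2 := by decide
  have h31 : (1 : Fin 4) ≠ 3 := by decide
  have hcsa : ∀ (g : ℝ → ℝ), IsSemialgebraicFunOn ℚ (Set.pi Set.univ (fun _ : Fin 1 => Set.Icc (0:ℝ) 1)) (fun w => g (w 0)) → ∀ c ∈ Set.Icc (0:ℝ) 1, IsAlgebraic ℚ c →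
      IsSemialgebraicFunOn ℚ (Set.pi Set.univ (fun _ : Fin 1 => Set.Icc (0:ℝ) 1)) (fun _ : Fin 1 → ℝ => g c) := fun g hg c hc hca =>
    isSemialgebraicFunOn_const_of_isAlgebraic hS1 (hg.isAlgebraic_apply (a := fun _ => c) (fun _ _ => hc) fun _ => hca)
  set ωk : Fin N → ℝ → ℝ := fun k u => (U k u * W' k u - U' k u * W k u) / (U k u ^ 2 + W k u ^ 2) with hωk_def
  have hT : ∀ k : Fin N, FibStokesDecomposable 4 (fun x => γ * (ωk k (x 0) - ωk k (x 1))) := by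
    intro k
    obtain ⟨Bd, hBd⟩ := hbd k
    obtain ⟨G₀, D₀, K₀, r₀, hp₀, hr₀, hid₀⟩ := stub_kinkedAngTransport γ (U k) (W k) (U k) (W k) (U' k) (W' k) (U' k) (W' k)
      {z k, z (k + 1)} {z k, z (k + 1)} hγ (hUsa k) (hWsa k) (hUsa k) (hWsa k) (hU'sa k) (hW'sa k) (hU'sa k) (hW'sa k)
      (hUc k) (hWc k) (hUc k) (hWc k) ⟨Bd, fun u hu => ⟨(hBd u hu).1, (hBd u hu).2, (hBd u hu).1, (hBd u hu).2⟩⟩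
      (fun c hc => by
        simp only [Finset.mem_insert, Finset.mem_singleton] at hc
        rcases hc with rfl | rfl <;> exact hz_alg _)
      (fun c hc => by
        simp only [Finset.mem_insert, Finset.mem_singleton] at hc
        rcases hc with rfl | rfl <;> exact hz_alg _)
      (fun u hu hnot => hder k u hu (fun h => hnot (by simp [h])) (fun h => hnot (by simp [h])))
      (fun u hu hnot => hder k u hu (fun h => hnot (by simp [h])) (fun h => hnot (by simp [h])))
      (hUpos k) (hUpos k)
    obtain ⟨G₁, D₁, r₁, hp₁, hr₁, hid₁⟩ := stub_paramHalfAngleCertificate γ 1 (U k) (W k)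
      (fun _ => U k 1) (fun _ => W k 1) hγ h21 h31 (hUsa k) (hWsa k) (hcsa _ (hUsa k) 1 h1 isAlgebraic_one)
      (hcsa _ (hWsa k) 1 h1 isAlgebraic_one) (hUc k) (hWc k) continuousOn_const continuousOn_const (hUpos k)
      (fun _ _ => hUpos k 1 h1)
    obtain ⟨G₂, D₂, r₂, hp₂, hr₂, hid₂⟩ := stub_paramHalfAngleCertificate γ 1 (U k) (W k)
      (fun _ => U k 0) (fun _ => W k 0) hγ h21 h31 (hUsa k) (hWsa k) (hcsa _ (hUsa k) 0 h0 isAlgebraic_zero)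
      (hcsa _ (hWsa k) 0 h0 isAlgebraic_zero) (hUc k) (hWc k) continuousOn_const continuousOn_const (hUpos k)
      (fun _ _ => hUpos k 0 h0)
    obtain ⟨G₃, D₃, r₃, hp₃, hr₃, hid₃⟩ := stub_paramHalfAngleCertificate γ 0 (fun _ => U k 1) (fun _ => W k 1)
      (U k) (W k) hγ h20.symm h30.symm (hcsa _ (hUsa k) 1 h1 isAlgebraic_one) (hcsa _ (hWsa k) 1 h1 isAlgebraic_one)
      (hUsa k) (hWsa k) continuousOn_const continuousOn_const (hUc k) (hWc k) (fun _ _ => hUpos k 1 h1) (hUpos k)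
    obtain ⟨G₄, D₄, r₄, hp₄, hr₄, hid₄⟩ := stub_paramHalfAngleCertificate γ 0 (fun _ => U k 0) (fun _ => W k 0)
      (U k) (W k) hγ h20.symm h30.symm (hcsa _ (hUsa k) 0 h0 isAlgebraic_zero) (hcsa _ (hWsa k) 0 h0 isAlgebraic_zero)
      (hUsa k) (hWsa k) continuousOn_const continuousOn_const (hUc k) (hWc k) (fun _ _ => hUpos k 0 h0) (hUpos k)
    have hd₀ := fibStokesDecomposable_of_elementsK _ G₀ D₀ K₀ r₀ hp₀ hr₀
    have hd₁ := fibStokesDecomposable_of_elements _ G₁ D₁ r₁ hp₁ hr₁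
    have hd₂ := fibStokesDecomposable_of_elements _ G₂ D₂ r₂ hp₂ hr₂
    have hd₃ := fibStokesDecomposable_of_elements _ G₃ D₃ r₃ hp₃ hr₃
    have hd₄ := fibStokesDecomposable_of_elements _ G₄ D₄ r₄ hp₄ hr₄
    have hsum := fibStokesDecomposable_sub 4 _ _
      (fibStokesDecomposable_add 4 _ _ (fibStokesDecomposable_sub 4 _ _ (fibStokesDecomposable_add 4 _ _ hd₀ hd₁) hd₂) hd₃) hd₄
    refine fibStokesDecomposable_congr_off_null 4 _ _ ∅ Literature.ModelTheory.ExponentialFields.isSemialgebraic_empty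
      measure_empty (fun x hx _ => ?_) hsum
    rw [hid₀ x hx, hid₁ x hx, hid₂ x hx, hid₃ x hx, hid₄ x hx]
    simp only [hωk_def]
    ring
  -- Step 4: sum over the pieces and un-pad
  have h24 : (2:ℕ) ≤ 4 := by norm_num
  have hsumT := fibStokesDecomposable_finsetSum Finset.univ _ fun k _ => hT k
  have h4 : FibStokesDecomposable 4 (fun x => γ * (∑ k, ωk k (x 0) - ∑ k, ωk k (x 1))) := by
    refine fibStokesDecomposable_congr_off_null 4 _ _ ∅ Literature.ModelTheory.ExponentialFields.isSemialgebraic_empty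
      measure_empty (fun x _ _ => ?_) hsumT
    rw [← Finset.sum_sub_distrib, Finset.mul_sum]
  have h2 : FibStokesDecomposable 2 (fun w => γ * (∑ k, ωk k (w 0) - ∑ k, ωk k (w 1))) :=
    fibStokesDecomposable_unpad h24 _ h4
  -- Step 5: off the grid, `Σₖ ωₖ = ω`
  set Z : Set (Fin 2 → ℝ) := (⋃ k ∈ Finset.range (N + 1), {w : Fin 2 → ℝ | w 0 = z k}) ∪
    ⋃ k ∈ Finset.range (N + 1), {w : Fin 2 → ℝ | w 1 = z k} with hZ
  have hZsa : IsSemialgebraic ℚ Z :=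
    (Literature.ModelTheory.ExponentialFields.IsSemialgebraic.biUnion (k := ℚ) (Finset.range (N + 1))
      (fun k => {w : Fin 2 → ℝ | w 0 = z k}) fun k _ => isSemialgebraic_setOf_apply_eq_of_isAlgebraic (hz_alg k) 0).union
    (Literature.ModelTheory.ExponentialFields.IsSemialgebraic.biUnion (k := ℚ) (Finset.range (N + 1))
      (fun k => {w : Fin 2 → ℝ | w 1 = z k}) fun k _ => isSemialgebraic_setOf_apply_eq_of_isAlgebraic (hz_alg k) 1)
  have hZvol : volume Z = 0 := by
    refine measure_union_null ?_ ?_ <;>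
      refine (measure_biUnion_null_iff (Finset.range (N + 1)).countable_toSet).mpr fun k _ => ?_ <;>
      · rw [volume_pi]; exact Measure.pi_hyperplane _ _ _
  have hωsum : ∀ u ∈ Set.Icc (0:ℝ) 1, (∀ k : ℕ, k ≤ N → u ≠ z k) → ∑ k : Fin N, ωk k u = ω u := by
    intro u hu hgrid
    obtain ⟨k₀, hk₀N, hk₀in, hk₀uniq⟩ := exists_unique_piece hN1 hu hgrid
    rw [Finset.sum_eq_single ⟨k₀, hk₀N⟩]
    · show (U ⟨k₀, hk₀N⟩ u * W' ⟨k₀, hk₀N⟩ u - U' ⟨k₀, hk₀N⟩ u * W ⟨k₀, hk₀N⟩ u) /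
          (U ⟨k₀, hk₀N⟩ u ^ 2 + W ⟨k₀, hk₀N⟩ u ^ 2) = ω u
      rw [hωk ⟨k₀, hk₀N⟩ u hu (hgrid k₀ hk₀N.le) (hgrid (k₀ + 1) hk₀N), if_pos (by simpa [hz, hz_succ] using hk₀in)]
    · intro k _ hk
      show (U k u * W' k u - U' k u * W k u) / (U k u ^ 2 + W k u ^ 2) = 0
      rw [hωk k u hu (hgrid k (Nat.le_of_lt k.2)) (hgrid (k + 1) k.2), if_neg]
      intro hcond
      apply hk
      ext
      exact hk₀uniq k (by simpa [hz, hz_succ] using hcond)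
    · intro hk; exact absurd (Finset.mem_univ _) hk
  refine fibStokesDecomposable_congr_off_null 2 _ _ Z hZsa hZvol (fun w hw hwZ => ?_) h2
  have hgrid : ∀ i : Fin 2, ∀ k : ℕ, k ≤ N → w i ≠ z k := by
    intro i k hk hwk
    apply hwZ
    fin_cases i
    · exact Or.inl (Set.mem_iUnion₂.mpr ⟨k, Finset.mem_range.mpr (Nat.lt_succ_of_le hk), hwk⟩)
    · exact Or.inr (Set.mem_iUnion₂.mpr ⟨k, Finset.mem_range.mpr (Nat.lt_succ_of_le hk), hwk⟩)
  rw [hωsum (w 0) (hw 0 (Set.mem_univ _)) (hgrid 0), hωsum (w 1) (hw 1 (Set.mem_univ _)) (hgrid 1)]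

end Summit.KontsevichZagierPeriods.KontsevichZagierPeriods.Cruxes.StokesGeneration.FibrewiseStokes

end
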